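import Summits.QuantumFields.YangMills.Theorems.ChatterjeeMassGapTorusAxialBoxBit
import HarnessLib

/-!
# S28ᵀ (Chatterjee torus-axial mass gap) — one free link on `ℤᵈ` (ym-idea-4 g6, LINE-11)

Bears on rung S28ᵀ (`s28TorusAxial_iff_gapCore`) through the typed fork
`S28BoxBit.gapCore_eventually_of_boxCumulant` (LINE-10): both of its hypotheses — (O1) cumulant
locality `p_Λ⁽⁸⁾(0) = 8!·κ_□` and (O2) the box integral `κ_□ ≠ 0` — are evaluated by ONE device,
the averaging over a link that occurs in exactly one factor of a product of plaquette observables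
("Haar absorption"): under the free product measure `dg_∞ = zdHaar d G` on `G^{edges(ℤᵈ)}`,

  `∫ φ(A(U)·U_ℓ·B(U)) · Y(U) dg_∞ = (∫_G φ dg) · ∫ Y dg_∞`

whenever `A`, `B`, `Y` do not feel a right shear `U_ℓ ↦ U_ℓ·g` of the link `ℓ`
(`integral_mul_eq_of_freeLink`; the inverted-letter form `φ(A·U_ℓ⁻¹·B)` is
`integral_mul_eq_of_freeLink_inv`). This is the `ℤᵈ` (infinite product, `Measure.infinitePi`)
counterpart of the torus lemma `S28BetaZeroUltraLocal.integral_mul_eq_of_freeEdge` (finite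
`Measure.pi`); the new input is that the one-coordinate shear preserves the INFINITE product Haar
measure (`measurePreserving_shear`, from Mathlib's `Measure.infinitePi_map_pi` and right invariance
of Haar measure on the compact group).

Consequences for plaquettes (`integral_plaquetteObs_mul_eq_of_freeLink`,
`integral_centred_plaquetteObs_mul_eq_zero`): if `ℓ` is any of the four links of the
plaquette `(x; i, j)` (`i ≠ j`) and the continuous observable `Y` does not feel the shear of `ℓ`,
then
`∫ Re tr ρ(U_{x;ij}) · Y dg_∞ = m₀(ρ) · ∫ Y dg_∞` with `m₀(ρ) = ∫_G Re tr ρ dg`,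
i.e. the CENTRED plaquette observable is orthogonal to every such `Y`. In the (O1) blueprint
this is the step "a position whose plaquette has a private link makes the joint cumulant vanish"
(with
`Literature.Probability.LatticeModels.ursellOf_eq_zero_of_factorises`) and the step "the joint
cumulant of the ten faces of `∂B` is their centred moment" (every proper sub-surface of `∂B` has a
free edge); in (O2) it is each of the nine convolution / gauge-fixing steps. Blueprint:
pub/ideators/ym-idea-4/bc/g6/O1O2-PLAN.md.

Cheapest falsifier / instrument row: none needed — these are identities of Haar measure; the
numerical rows they feed are κ_□(U(1)) = 2⁻⁹ (exact) and κ_□(SU(2)) = 2⁻⁸ (MC 3.88e-3 ± 1.6e-4,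
kit j305003). No summit is proved here: the file supplies measure-theoretic glue for the island
(small-β) case of the S28ᵀ gap core only.
-/

noncomputable section

open MeasureTheory Filter Topology
open Literature.MathematicalPhysics.QuantumLattice
open Literature.MathematicalPhysics.QuantumFieldTheory (zdHaar haarProbability)
open Literature.Probability.LatticeModels (Site)

namespace Summit.QuantumFields.YangMills.Theorems.S28FreeLink

variable {N : ℕ} {G : Type} [Group G] [TopologicalSpace G] [IsTopologicalGroup G]
  [CompactSpace G] [MeasurableSpace G] [BorelSpace G] (ρ : G →* Matrix (Fin N) (Fin N) ℂ)
variable {d : ℕ}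

/-! ### The one-link shear preserves the infinite product Haar measure -/

omit [TopologicalSpace G] [IsTopologicalGroup G] [CompactSpace G] [MeasurableSpace G]
  [BorelSpace G] in
/-- The shear does not move the other links. [folklore] -/
theorem shear_apply_of_ne {ℓ e : ZdEdge d} (h : e ≠ ℓ) (U : LGConfig d G) (g : G) :
    (if e = ℓ then U e * g else U e) = U e :=
  if_neg h

omit [TopologicalSpace G] [IsTopologicalGroup G] [CompactSpace G] [MeasurableSpace G]
  [BorelSpace G] in
/-- The shear right-multiplies the distinguished link. [folklore] -/
theorem shear_apply_self (ℓ : ZdEdge d) (U : LGConfig d G) (g : G) :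
    (if ℓ = ℓ then U ℓ * g else U ℓ) = U ℓ * g :=
  if_pos rfl

omit [TopologicalSpace G] [IsTopologicalGroup G] [CompactSpace G] [MeasurableSpace G]
  [BorelSpace G] in
/-- An observable depending only on links in `S ∌ ℓ` does not feel the shear of `ℓ`. [folklore] -/
theorem shear_invariant_of_dependsOn {β : Type*} {Y : LGConfig d G → β} {S : Set (ZdEdge d)}
    (hY : DependsOn Y S) {ℓ : ZdEdge d} (hℓ : ℓ ∉ S) (U : LGConfig d G) (g : G) :
    Y (fun e' : ZdEdge d => if e' = ℓ then U e' * g else U e') = Y U :=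
  hY fun _ he => if_neg (ne_of_mem_of_not_mem he hℓ)

/-- **Right-shearing ONE link preserves `dg_∞`.** The map `U ↦ (U with U_ℓ replaced by U_ℓ·g)`
preserves the infinite product `zdHaar d G` of normalised Haar measures (Mathlib's
`Measure.infinitePi_map_pi`: a coordinatewise measurable map pushes `infinitePi μ` to the
`infinitePi` of the pushed marginals; the `ℓ`-marginal is preserved by right invariance of Haar
measure on the compact — hence unimodular — group, the others by the identity). [folklore] -/
theorem measurePreserving_shear (ℓ : ZdEdge d) (g : G) :
    MeasurePreserving
      (fun (U : LGConfig d G) (e' : ZdEdge d) => if e' = ℓ then U e' * g else U e')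
      (zdHaar d G) (zdHaar d G) := by
  have hf : ∀ e : ZdEdge d, Measurable fun y : G => if e = ℓ then y * g else y := by
    intro e
    by_cases he : e = ℓ
    · simp only [he, if_true]
      exact measurable_mul_const g
    · simp only [he, if_false]
      exact measurable_id
  refine ⟨measurable_pi_lambda _ fun e => (hf e).comp (measurable_pi_apply e), ?_⟩
  have hmarg : (fun e : ZdEdge d =>
      (haarProbability G).map fun y : G => if e = ℓ then y * g else y) =
      fun _ => haarProbability G := by
    funext e
    by_cases he : e = ℓ
    · simp only [he, if_true]
      exact map_mul_right_eq_self _ g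
    · simp only [he, if_false]
      exact Measure.map_id
  show Measure.map (fun (U : LGConfig d G) (e' : ZdEdge d) =>
      (fun (e : ZdEdge d) (y : G) => if e = ℓ then y * g else y) e' (U e'))
      (Measure.infinitePi fun _ : ZdEdge d => haarProbability G) =
    Measure.infinitePi fun _ : ZdEdge d => haarProbability G
  rw [Measure.infinitePi_map_pi (μ := fun _ : ZdEdge d => haarProbability G) hf, hmarg]

/-! ### Free-link averaging -/

/-- A continuous real observable is `dg_∞`-integrable (`G` second countable). [folklore] -/
theorem integrable_of_continuous [SecondCountableTopology G] {F : LGConfig d G → ℝ}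
    (hF : Continuous F) : Integrable F (zdHaar d G) := by
  obtain ⟨C, hC⟩ := isCompact_univ.exists_bound_of_continuousOn hF.continuousOn
  exact (integrable_const C).mono' hF.aestronglyMeasurable
    (Eventually.of_forall fun U => by simpa using hC U (Set.mem_univ U))

/-- **Free-link averaging on `ℤᵈ`.** Under `dg_∞`, an observable `U ↦ φ(A(U)·U_ℓ·B(U))` whose
outer factors `A`, `B` do not feel the right shear of the link `ℓ`, is uncorrelated with every
continuous observable `Y` that does not feel it either:
`∫ φ(A·U_ℓ·B)·Y dg_∞ = (∫_G φ dg)·∫ Y dg_∞` (shear invariance of `dg_∞`, average over the shear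
parameter, Fubini, two-sided invariance of Haar measure). The `ℤᵈ` counterpart of
`S28BetaZeroUltraLocal.integral_mul_eq_of_freeEdge`. [folklore] -/
theorem integral_mul_eq_of_freeLink [SecondCountableTopology G] (ℓ : ZdEdge d)
    {φ : G → ℝ} (hφ : Continuous φ) {A B : LGConfig d G → G} (hAc : Continuous A)
    (hBc : Continuous B)
    (hA : ∀ (U : LGConfig d G) (g : G),
      A (fun e' => if e' = ℓ then U e' * g else U e') = A U)
    (hB : ∀ (U : LGConfig d G) (g : G),
      B (fun e' => if e' = ℓ then U e' * g else U e') = B U)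
    {Y : LGConfig d G → ℝ} (hYc : Continuous Y)
    (hY : ∀ (U : LGConfig d G) (g : G),
      Y (fun e' => if e' = ℓ then U e' * g else U e') = Y U) :
    ∫ U, φ (A U * U ℓ * B U) * Y U ∂zdHaar d G =
      (∫ h, φ h ∂haarProbability G) * ∫ U, Y U ∂zdHaar d G := by
  set π : Measure (LGConfig d G) := zdHaar d G
  obtain ⟨Cφ, hCφ⟩ := isCompact_univ.exists_bound_of_continuousOn hφ.continuousOn
  obtain ⟨CY, hCY⟩ := isCompact_univ.exists_bound_of_continuousOn hYc.continuousOn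
  have hF : Continuous fun U : LGConfig d G => φ (A U * U ℓ * B U) * Y U :=
    (hφ.comp ((hAc.mul (continuous_apply ℓ)).mul hBc)).mul hYc
  -- shear invariance for every fixed `g`, then average over `g`
  have step1 : ∀ g : G,
      ∫ U, φ (A U * U ℓ * B U) * Y U ∂π = ∫ U, φ (A U * (U ℓ * g) * B U) * Y U ∂π := by
    intro g
    have hΦ := measurePreserving_shear (d := d) (G := G) ℓ g
    have key := integral_map (μ := π) hΦ.measurable.aemeasurable
      (f := fun U : LGConfig d G => φ (A U * U ℓ * B U) * Y U) hF.aestronglyMeasurable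
    rw [hΦ.map_eq] at key
    rw [key]
    refine integral_congr_ae (Eventually.of_forall fun U => ?_)
    beta_reduce
    rw [if_pos rfl, hA U g, hB U g, hY U g]
  have hconst : ∫ U, φ (A U * U ℓ * B U) * Y U ∂π =
      ∫ g, ∫ U, φ (A U * (U ℓ * g) * B U) * Y U ∂π ∂haarProbability G := by
    have : (fun g : G => ∫ U, φ (A U * (U ℓ * g) * B U) * Y U ∂π) =
        fun _ => ∫ U, φ (A U * U ℓ * B U) * Y U ∂π := funext fun g => (step1 g).symm
    rw [this, integral_const, probReal_univ, one_smul]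
  -- Fubini
  have hH : Continuous fun p : G × LGConfig d G =>
      φ (A p.2 * (p.2 ℓ * p.1) * B p.2) * Y p.2 :=
    (hφ.comp (((hAc.comp continuous_snd).mul
      (((continuous_apply ℓ).comp continuous_snd).mul continuous_fst)).mul
      (hBc.comp continuous_snd))).mul (hYc.comp continuous_snd)
  have hint : Integrable (fun p : G × LGConfig d G =>
      φ (A p.2 * (p.2 ℓ * p.1) * B p.2) * Y p.2) ((haarProbability G).prod π) := by
    refine (integrable_const (Cφ * CY)).mono' hH.aestronglyMeasurable
      (Eventually.of_forall fun p => ?_)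
    rw [Real.norm_eq_abs, abs_mul]
    exact mul_le_mul (by simpa using hCφ _ (Set.mem_univ _))
      (by simpa using hCY _ (Set.mem_univ _)) (abs_nonneg _)
      ((norm_nonneg _).trans (hCφ (A p.2 * (p.2 ℓ * p.1) * B p.2) (Set.mem_univ _)))
  rw [hconst, integral_integral_swap (f := fun (g : G) (U : LGConfig d G) =>
    φ (A U * (U ℓ * g) * B U) * Y U) hint]
  -- the inner integral is the constant `∫ φ` (two-sided invariance of Haar measure)
  have hinner : ∀ U : LGConfig d G,
      ∫ g, φ (A U * (U ℓ * g) * B U) * Y U ∂haarProbability G =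
        (∫ h, φ h ∂haarProbability G) * Y U := by
    intro U
    rw [integral_mul_const]
    congr 1
    have h1 := integral_mul_left_eq_self (μ := haarProbability G)
      (fun g => φ (A U * g * B U)) (U ℓ)
    have h2 := integral_mul_left_eq_self (μ := haarProbability G)
      (fun g => φ (g * B U)) (A U)
    have h3 := integral_mul_right_eq_self (μ := haarProbability G) φ (B U)
    simp only [← mul_assoc] at h1 h2 ⊢
    rw [h1, h2, h3]
  simp_rw [hinner]
  exact integral_const_mul _ _

/-- **Free-link averaging, inverted letter.** The same with the link entering as `U_ℓ⁻¹`: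
`∫ φ(A·U_ℓ⁻¹·B)·Y dg_∞ = (∫_G φ dg)·∫ Y dg_∞` (apply the direct form to `φ ∘ (·)⁻¹` and the word
`B⁻¹·U_ℓ·A⁻¹`, then inversion invariance of Haar measure). [folklore] -/
theorem integral_mul_eq_of_freeLink_inv [SecondCountableTopology G] (ℓ : ZdEdge d)
    {φ : G → ℝ} (hφ : Continuous φ) {A B : LGConfig d G → G} (hAc : Continuous A)
    (hBc : Continuous B)
    (hA : ∀ (U : LGConfig d G) (g : G),
      A (fun e' => if e' = ℓ then U e' * g else U e') = A U)
    (hB : ∀ (U : LGConfig d G) (g : G),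
      B (fun e' => if e' = ℓ then U e' * g else U e') = B U)
    {Y : LGConfig d G → ℝ} (hYc : Continuous Y)
    (hY : ∀ (U : LGConfig d G) (g : G),
      Y (fun e' => if e' = ℓ then U e' * g else U e') = Y U) :
    ∫ U, φ (A U * (U ℓ)⁻¹ * B U) * Y U ∂zdHaar d G =
      (∫ h, φ h ∂haarProbability G) * ∫ U, Y U ∂zdHaar d G := by
  have hI : ∫ h, φ h⁻¹ ∂haarProbability G = ∫ h, φ h ∂haarProbability G :=
    integral_inv_eq_self (fun h : G => φ h) _
  have key := integral_mul_eq_of_freeLink ℓ (φ := fun h : G => φ h⁻¹)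
    (A := fun U => (B U)⁻¹) (B := fun U => (A U)⁻¹) (Y := Y) (hφ.comp continuous_inv) hBc.inv
    hAc.inv (fun U g => by simp only [hB U g]) (fun U g => by simp only [hA U g]) hYc hY
  simp only [mul_inv_rev, inv_inv] at key
  rw [hI] at key
  simpa only [mul_assoc] using key

/-! ### Plaquettes: a free link averages the plaquette observable to `m₀(ρ)` -/

omit [TopologicalSpace G] [IsTopologicalGroup G] [CompactSpace G] [MeasurableSpace G]
  [BorelSpace G] in
/-- Links with different directions differ. [folklore] -/
theorem link_ne_of_dir_ne {x y : Site d} {i j : Fin d} (h : i ≠ j) :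
    ((x, i) : ZdEdge d) ≠ (y, j) :=
  fun H => h (congrArg Prod.snd H)

omit [TopologicalSpace G] [IsTopologicalGroup G] [CompactSpace G] [MeasurableSpace G]
  [BorelSpace G] in
/-- Links with different base points differ. [folklore] -/
theorem link_ne_of_site_ne {x y : Site d} (i j : Fin d) (h : x ≠ y) :
    ((x, i) : ZdEdge d) ≠ (y, j) :=
  fun H => h (congrArg Prod.fst H)

omit [TopologicalSpace G] [IsTopologicalGroup G] [CompactSpace G] [MeasurableSpace G]
  [BorelSpace G] in
/-- The plaquette holonomy read from each of its four letters:
`U_{x;ij} = 1·a·(b c⁻¹ e⁻¹) = a·b·(c⁻¹ e⁻¹) = (a b)·c⁻¹·e⁻¹ = (a b c⁻¹)·e⁻¹·1` with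
`a = U(x,i)`, `b = U(x+eᵢ,j)`, `c = U(x+eⱼ,i)`, `e = U(x,j)`. [folklore] -/
theorem plaquetteHolonomyZd_letters (U : LGConfig d G) (x : Site d) (i j : Fin d) :
    plaquetteHolonomyZd U x i j =
        1 * U (x, i) * (U (x + Pi.single i 1, j) * (U (x + Pi.single j 1, i))⁻¹ * (U (x, j))⁻¹) ∧
      plaquetteHolonomyZd U x i j =
        U (x, i) * U (x + Pi.single i 1, j) * ((U (x + Pi.single j 1, i))⁻¹ * (U (x, j))⁻¹) ∧
      plaquetteHolonomyZd U x i j =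
        U (x, i) * U (x + Pi.single i 1, j) * (U (x + Pi.single j 1, i))⁻¹ * (U (x, j))⁻¹ ∧
      plaquetteHolonomyZd U x i j =
        U (x, i) * U (x + Pi.single i 1, j) * (U (x + Pi.single j 1, i))⁻¹ * (U (x, j))⁻¹ * 1 := by
  refine ⟨?_, ?_, rfl, ?_⟩ <;> simp only [plaquetteHolonomyZd, one_mul, mul_one, mul_assoc]

/-- **A free link averages the plaquette to `m₀(ρ)`.** If `ℓ` is one of the four links of the
plaquette `(x; i, j)` (`i ≠ j`) and the continuous observable `Y` does not feel the right shear
of `ℓ`, then `∫ Re tr ρ(U_{x;ij})·Y dg_∞ = m₀(ρ)·∫ Y dg_∞` with `m₀(ρ) = ∫_G Re tr ρ dg`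
(`integral_mul_eq_of_freeLink` / `_inv` on the letter `ℓ`; the other three letters of the
plaquette are links different from `ℓ`, so they do not feel the shear). [folklore] -/
theorem integral_plaquetteObs_mul_eq_of_freeLink [SecondCountableTopology G]
    (hρ : Continuous ρ) (x : Site d) {i j : Fin d} (hij : i ≠ j) {ℓ : ZdEdge d}
    (hℓ : ℓ = (x, i) ∨ ℓ = (x + Pi.single i 1, j) ∨ ℓ = (x + Pi.single j 1, i) ∨ ℓ = (x, j))
    {Y : LGConfig d G → ℝ} (hYc : Continuous Y)
    (hY : ∀ (U : LGConfig d G) (g : G),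
      Y (fun e' => if e' = ℓ then U e' * g else U e') = Y U) :
    ∫ U, plaquetteObs ρ x i j U * Y U ∂zdHaar d G =
      (∫ g, (ρ g).trace.re ∂haarProbability G) * ∫ U, Y U ∂zdHaar d G := by
  have hφ : Continuous fun h : G => (ρ h).trace.re := Complex.continuous_re.comp hρ.matrix_trace
  have h12 : ((x, i) : ZdEdge d) ≠ (x + Pi.single i 1, j) := link_ne_of_dir_ne hij
  have h13 : ((x, i) : ZdEdge d) ≠ (x + Pi.single j 1, i) :=
    link_ne_of_site_ne i i fun h => by simpa using congrFun h j
  have h14 : ((x, i) : ZdEdge d) ≠ (x, j) := link_ne_of_dir_ne hij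
  have h23 : ((x + Pi.single i 1, j) : ZdEdge d) ≠ (x + Pi.single j 1, i) :=
    link_ne_of_dir_ne (Ne.symm hij)
  have h24 : ((x + Pi.single i 1, j) : ZdEdge d) ≠ (x, j) :=
    link_ne_of_site_ne j j fun h => by simpa using congrFun h i
  have h34 : ((x + Pi.single j 1, i) : ZdEdge d) ≠ (x, j) := link_ne_of_dir_ne hij
  unfold plaquetteObs
  rcases hℓ with rfl | rfl | rfl | rfl
  · -- first letter `a = U (x, i)`
    have key := integral_mul_eq_of_freeLink (x, i) (φ := fun h : G => (ρ h).trace.re)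
      (A := fun _ : LGConfig d G => (1 : G))
      (B := fun U : LGConfig d G =>
        U (x + Pi.single i 1, j) * (U (x + Pi.single j 1, i))⁻¹ * (U (x, j))⁻¹)
      (Y := Y) hφ continuous_const (by fun_prop) (fun U g => rfl)
      (fun U g => by simp only [if_neg h12.symm, if_neg h13.symm, if_neg h14.symm]) hYc hY
    refine Eq.trans (integral_congr_ae (Eventually.of_forall fun U => ?_)) key
    beta_reduce
    rw [(plaquetteHolonomyZd_letters U x i j).1]
  · -- second letter `b = U (x + eᵢ, j)`
    have key := integral_mul_eq_of_freeLink (x + Pi.single i 1, j)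
      (φ := fun h : G => (ρ h).trace.re) (A := fun U : LGConfig d G => U (x, i))
      (B := fun U : LGConfig d G => (U (x + Pi.single j 1, i))⁻¹ * (U (x, j))⁻¹)
      (Y := Y) hφ (continuous_apply _) (by fun_prop)
      (fun U g => by simp only [if_neg h12])
      (fun U g => by simp only [if_neg h23.symm, if_neg h24.symm]) hYc hY
    refine Eq.trans (integral_congr_ae (Eventually.of_forall fun U => ?_)) key
    beta_reduce
    rw [(plaquetteHolonomyZd_letters U x i j).2.1]
  · -- third letter `c⁻¹ = (U (x + eⱼ, i))⁻¹`
    have key := integral_mul_eq_of_freeLink_inv (x + Pi.single j 1, i)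
      (φ := fun h : G => (ρ h).trace.re)
      (A := fun U : LGConfig d G => U (x, i) * U (x + Pi.single i 1, j))
      (B := fun U : LGConfig d G => (U (x, j))⁻¹) (Y := Y) hφ (by fun_prop) (by fun_prop)
      (fun U g => by simp only [if_neg h13, if_neg h23])
      (fun U g => by simp only [if_neg h34.symm]) hYc hY
    refine Eq.trans (integral_congr_ae (Eventually.of_forall fun U => ?_)) key
    beta_reduce
    rw [(plaquetteHolonomyZd_letters U x i j).2.2.1]
  · -- fourth letter `e⁻¹ = (U (x, j))⁻¹`
    have key := integral_mul_eq_of_freeLink_inv (x, j) (φ := fun h : G => (ρ h).trace.re)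
      (A := fun U : LGConfig d G =>
        U (x, i) * U (x + Pi.single i 1, j) * (U (x + Pi.single j 1, i))⁻¹)
      (B := fun _ : LGConfig d G => (1 : G)) (Y := Y) hφ (by fun_prop) continuous_const
      (fun U g => by simp only [if_neg h14, if_neg h24, if_neg h34]) (fun U g => rfl) hYc hY
    refine Eq.trans (integral_congr_ae (Eventually.of_forall fun U => ?_)) key
    beta_reduce
    rw [(plaquetteHolonomyZd_letters U x i j).2.2.2]

/-- **The centred plaquette observable is orthogonal to everything that does not feel one of its
links.** With `m₀(ρ) = ∫_G Re tr ρ dg`: `∫ (Re tr ρ(U_{x;ij}) - m₀(ρ))·Y dg_∞ = 0` for every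
continuous `Y` not feeling the right shear of a link `ℓ` of the plaquette. In the (O1)/(O2)
blueprint: a plaquette with a PRIVATE link drops out of every centred product / joint cumulant.
[folklore] -/
theorem integral_centred_plaquetteObs_mul_eq_zero [SecondCountableTopology G]
    (hρ : Continuous ρ) (x : Site d) {i j : Fin d} (hij : i ≠ j) {ℓ : ZdEdge d}
    (hℓ : ℓ = (x, i) ∨ ℓ = (x + Pi.single i 1, j) ∨ ℓ = (x + Pi.single j 1, i) ∨ ℓ = (x, j))
    {Y : LGConfig d G → ℝ} (hYc : Continuous Y)
    (hY : ∀ (U : LGConfig d G) (g : G),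
      Y (fun e' => if e' = ℓ then U e' * g else U e') = Y U) :
    ∫ U, (plaquetteObs ρ x i j U - ∫ g, (ρ g).trace.re ∂haarProbability G) * Y U
      ∂zdHaar d G = 0 := by
  have hPc : Continuous (plaquetteObs (d := d) ρ x i j) := by
    unfold plaquetteObs plaquetteHolonomyZd
    fun_prop
  set m₀ : ℝ := ∫ g, (ρ g).trace.re ∂haarProbability G
  have h1 : Integrable (fun U : LGConfig d G => plaquetteObs ρ x i j U * Y U) (zdHaar d G) :=
    integrable_of_continuous (hPc.mul hYc)
  have h2 : Integrable (fun U : LGConfig d G => m₀ * Y U) (zdHaar d G) :=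
    integrable_of_continuous (continuous_const.mul hYc)
  calc ∫ U, (plaquetteObs ρ x i j U - m₀) * Y U ∂zdHaar d G
      = ∫ U, (plaquetteObs ρ x i j U * Y U - m₀ * Y U) ∂zdHaar d G :=
        integral_congr_ae (Eventually.of_forall fun U => sub_mul _ _ _)
    _ = (∫ U, plaquetteObs ρ x i j U * Y U ∂zdHaar d G) - ∫ U, m₀ * Y U ∂zdHaar d G :=
        integral_sub h1 h2
    _ = 0 := by
        rw [integral_const_mul, integral_plaquetteObs_mul_eq_of_freeLink ρ hρ x hij hℓ hYc hY,
          sub_self]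

/-- **Mean of a plaquette under `dg_∞`.** `∫ Re tr ρ(U_{x;ij}) dg_∞ = m₀(ρ)` (`i ≠ j`).
[folklore] -/
theorem integral_plaquetteObs [SecondCountableTopology G] (hρ : Continuous ρ) (x : Site d)
    {i j : Fin d} (hij : i ≠ j) :
    ∫ U, plaquetteObs ρ x i j U ∂zdHaar d G = ∫ g, (ρ g).trace.re ∂haarProbability G := by
  have h := integral_plaquetteObs_mul_eq_of_freeLink ρ hρ x hij (ℓ := (x, i)) (Or.inl rfl)
    (Y := fun _ => (1 : ℝ)) continuous_const (fun U g => rfl)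
  simpa [probReal_univ] using h

end Summit.QuantumFields.YangMills.Theorems.S28FreeLink
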